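import Literature.MathematicalPhysics.QuantumFieldTheory.Balaban1983to89.B7Prop5Flat
import Mathlib.Analysis.Calculus.FDeriv.Prod
import Mathlib.Analysis.Calculus.FDeriv.Pi
import Mathlib.Analysis.Calculus.Deriv.Prod

/-!
# `Balaban1983to89.B7Prop5FlatOperator` — [Balaban1985Averaging] Proposition 5 (156) p. 42 AT THE FLAT BACKGROUND in
OPERATOR form: the composite averaging `Q_k(1, ·)` as a Fréchet-differentiable map between FINITE sup-normed products of
bond variables, its partial derivatives identified with the single-bond differentials (137) of `B7Prop5Flat`, the row
count over `B^k(c₋) ∪ B^k(c₊)`, and the sup → sup bound `‖D Q_k(1, ·)‖ ≤ 2dL^k(1 + C₃L^kb)`, PROVED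

HONEST FRAMING (cell `lit-balaban`, verbatim): statement-level skeleton of published theorems with citation tags; proofs
where landed; nothing here is a claim about the Yang–Mills mass gap.

CITATION HEADER.  T. Bałaban, *Averaging operations for lattice gauge theories*, Commun. Math. Phys. **98** (1985) 17–51
[Balaban1985Averaging] (cell paper B7; journal page = PDF page + 16), Sect. D pp. 38–42 [PDF 22–26]; the printed sentences
quoted below are carried VERBATIM from the header transcript of the tree file `B7Prop5Flat` (renders
`b2b-balaban-ref1/pages/1985-cmp98-averaging/…-p023-x2.png` – `-p026-x2.png`, read as images by that lineage).  Unit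
`lit-balaban-r20` gen 3 (fold owner of B12): this file is the B7-side INSTANCE of the B7/B12 junction for [Balaban1987RG1]
(3.49) (`B12Ineq349PerBond`, same unit), NOT a claim on a SKELETON row (B7.Prop5 is typed/proved-existing: `B7.Prop5Printed`,
`B7Prop5Flat.prop5_flat_156/157`, `B7Prop5GeneralInduction.prop5_156/157`).  Companions REUSED BY NAME (never restated):
`B7Prop5Flat` (b07 gen 18: `bump`, `dC`, `K5`, `C3`, `prop5_flat_156_B`, `prop5_flat_157_B`, `linQIter_bump_eq_zero`,
`boxFinset`/`bondsIn`/`mem_bondsIn`, `small32_of_C3`), `B7Prop4Flat` (b07 gen 17: `logIter`, `linQIter`,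
`prop4_flat_analyticAt`, `C1_pos`), `B7Prop3Flat` (`insCfg`, `analyticAt_insCfg`, `norm_insCfg_le`, `insCfg_smul`),
`B7Prop1Local` (`loK`, `bondHiK`, `BondIn`).

THE PRINTED TEXT (verbatim, [Balaban1985Averaging]).  p. 39: «If F(A) is a differentiable function defined at field
configurations A on Ω, then the differential dF(A, δA) = (d/dt) F(A + tδA)|_{t=0} (137) is a linear functional of the
variable δA and can be represented as a scalar product of δA and some Lie algebra valued function. This function is called
the functional derivative and is denoted by (δ/δA) F(A), thus we have (d/dt) F(A + tδA)|_{t=0} = Σ_{b⊂Ω} η^d tr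
(δF(A)/δA_b) δA_b = ⟨δF(A)/δA, δA⟩. (138) From this definition it follows easily that the functional derivative coincides
with partial derivatives (gradient) of F(A) multiplied by η^{−d}. We would like to prove that the functional derivative of
Q_k(U₀, ηA) is bounded by a constant independent of η.»  (141) p. 39: «(Q″_kA)_c = Σ_{b⊂B^k(c₋)∪B^k(c₊)} η^dA_b, c ⊂
Ω^{(k)}».  p. 40, (150): «Q_j(U₀, ηA) = L^jηQ_j(U₀)A + C_j(U₀, L^jηA)».  p. 42: «**Proposition 5.** The functional
derivative of Q_k(U₀, ηA) is a bounded function for α₀, α₁ sufficiently small, and we have the bounds |(δ/δA_b) Q_k(U₀,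
ηA, c)| ≤ 1 + 2C′₁α₀ + C₃|A| < 1 + 2C′₁α₀ + C₃α₁, (156) |(δ/δA_b) C_k(U₀, A, c)| ≤ C₃|A| < C₃α₁. (157)»  Prop. 4, p. 38:
«the function Q_k(U₀, ηA, c) = (1/i) log(U̿₁^k)_c, c ⊂ Ω^{(k)}, is an analytic function of the variables A_b, b ⊂
B^k(c₋)∪B^k(c₊).»

WHY THIS FILE.  `B7Prop5Flat` proves (156)/(157) at `U₀ = 1` PER BOND, as bounds on the single-bond differentials (137)
`d/dt Q_k(1, B + tX·δ_b)(c)|_{t=0}` (`HasLineDerivAt`, complex lines) on the INFINITE unit lattice `ℤ^d → 𝔸`, which carries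
no norm.  The consumers in [Balaban1987RG1] ((3.49) p. 279 via `B12QPrime348.ineq349_lam330`; (4.17) p. 285) use the
functional derivative as an OPERATOR between sup-normed spaces of bond functions.  The passage is (138) («partial derivatives
multiplied by η^{−d}») summed over the bonds of (141): on the FINITE products `𝔸^S → 𝔸^T` the composite `Q_k(1, ·)` IS
Fréchet differentiable (analytic: Prop. 4, `B7Prop4Flat.prop4_flat_analyticAt`), its partial derivative in the direction
`X·δ_s` is b07's line derivative, and the operator norm is bounded by the largest row sum of the matrix of per-bond bounds.

DICTIONARY (as in `B7Prop5Flat`: `B`-variables `B = ηA` on the unit lattice `ℤ^d`, `η = L^{−k}`, `sup_b ‖B_b‖ ≤ b`, `L^kb`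
plays `α₁`; a bond of the `k`-th lattice is `c = (z, κ) : ℤ^d × Fin d`, read on the fine lattice as `⟨L^kz, L^kz + L^ke_κ⟩`;
its box `B^k(c₋) ∪ B^k(c₊)` is `[loK L k z, bondHiK L k z κ]`).  `S` = a finite set of fine bonds (the variables; all other
bond variables frozen at `0`, `B7Prop3Flat.insCfg`), `T` = a finite set of coarse bonds; **`avgMap L S T k a c = logIter L
(insCfg S a) k c`** = `Q_k(1, B)(c)` as a function `𝔸^S → 𝔸^T` of the inserted variables; the partial derivative in the
variable `s ∈ S` applied to `X ∈ 𝔸` = `fderiv ℂ (avgMap …) a (Pi.single s X)`; (138)'s `η^d·(δQ(c)/δB_s)·X` = that value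
(`B7Prop5Flat` DIVERGENCE (b)); the printed per-bond size (156) at `α₀ = 0`, in `B`-variables, = b07's
`L^k·L^{−kd} + K5 d L b k` (`= (1 + C₃|A|)·η^d·L^k`, the extra `L^k` being the un-normalisation `B = ηA` of the ARGUMENT
— exactly the `L^j` of (150) and of [I] (3.49)).

WHAT THIS FILE PROVES (kernel, 0 sorry, standard axioms; one object definition `avgMap`, no `def … : Prop`), for `L ≥ 2`,
any `d`, `k`, finite `S`, `T`, and `sup_s ‖a_s‖ ≤ b` with `C₃(d, L)·L^k·b ≤ 1` (b07's smallness):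
* §1 insertion algebra: `insCfg_add`, `insCfg_single` (`ins(X·δ_s) = bump s X`), `insCfg_line`.
* §2 `analyticAt_avgMap_apply`, `differentiableAt_avgMap` — Prop. 4's analyticity clause transported (BY NAME).
* §3 **`fderiv_avgMap_single`**: `∂_s Q_k(1,·)(c)·X = dC_k(B; X·δ_s)(c) + L^kη·Q_k(1)(X·δ_s)(c)` (b07's objects);
  **`norm_fderiv_avgMap_single_le`**: `≤ (L^kL^{−kd} + K5)‖X‖` ((156) at `α₀ = 0`, `prop5_flat_156_B` BY NAME);
  `fderiv_avgMap_single_eq_zero`: `= 0` unless `s ⊂ B^k(c₋) ∪ B^k(c₊)` (locality, (141)/Prop. 4).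
* §4 the row count: `card_boxFinset_K` (`#[loK, bondHiK] = 2·L^{kd}` sites), `card_bondsIn_le`, `card_filter_bondIn_le`
  (`≤ 2d·L^{kd}` bonds of `S` inside one box), `rowSum_avgMap_le` (`Σ_s M_{c,s} ≤ 2dL^k(1 + C₃L^kb)`).
* §5 **`opNorm_fderiv_avgMap_le`**: `‖D Q_k(1, ·)(B)‖_{sup→sup} ≤ 2dL^k(1 + C₃L^kb)` on `𝔸^S → 𝔸^T`, and the real-scalar
  forms `differentiableAt_avgMap_real`, `fderiv_real_avgMap_apply`, `opNorm_fderiv_real_avgMap_le` (the shape consumed by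
  `B12QPrime348.ineq349_lam330` / `B12Ineq349PerBond.ineq349_lam330_local`, which differentiate over `ℝ`).

DIVERGENCES / NOT PROVED.  Flat background only (`U₀ = 1`, `α₀ = 0`), as `B7Prop5Flat`; `ℤ^d`, no torus; the bound is in
`B`-variables (print's (156) is per bond in `A`-variables with the `η^d` of (138): the operator form in `A`-variables would
read `≤ 2d(1 + C₃α₁)`, the `L^k` here is the scale of the argument, cf. (150)); the count `2d·L^{kd}` is that of the box
`[L^kz, L^kz + (L^k − 1)𝟙 + L^ke_κ]` (print's `B^k(c₋) ∪ B^k(c₊)`), all `d` directions of bonds with lower endpoint and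
upper endpoint in the box.  Nothing of the curved background (`B7.Prop5Printed`) is used or claimed.
-/

noncomputable section

open scoped BigOperators
open NormedSpace Finset

namespace Literature.MathematicalPhysics.QuantumFieldTheory.Balaban1983to89.B7Prop5FlatOperator

open B7Prop1Explicit B7Prop1Local B7Prop3Flat B7Prop4Flat B7Prop5Flat

-- `Site` alone would resolve to the torus sites of `Setup.lean`; re-export the `ℤ^d` sites of `B7Prop1Explicit`.
export B7Prop1Explicit (Site)

variable {d : ℕ} {𝔸 : Type*} [NormedRing 𝔸] [NormedAlgebra ℂ 𝔸] [CompleteSpace 𝔸]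

/-! ## §1 Insertion algebra: `ins(a + t·X·δ_s) = ins(a) + t·bump_s X` -/

omit [NormedAlgebra ℂ 𝔸] [CompleteSpace 𝔸] in
/-- The insertion of finitely many bond variables is additive. [cite: Balaban1985Averaging, (109) p.34] (elementary API;
our proof) -/
theorem insCfg_add (S : Finset (Site d × Fin d)) (a a' : S → 𝔸) :
    insCfg S (a + a') = insCfg S a + insCfg S a' := by
  funext x κ
  by_cases h : (x, κ) ∈ S <;> simp [insCfg, h]

omit [NormedAlgebra ℂ 𝔸] [CompleteSpace 𝔸] in
/-- Inserting the coordinate vector `X·δ_s` (`Pi.single s X`) gives b07's single-bond variation `bump s X` («the variation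
singled out by `δ/δA_b`», (138)). [cite: Balaban1985Averaging, (138) p.39] (elementary API; our proof) -/
theorem insCfg_single (S : Finset (Site d × Fin d)) (s : S) (X : 𝔸) :
    insCfg S (Pi.single s X) = bump s.1.1 s.1.2 X := by
  funext x κ
  by_cases h : (x, κ) ∈ S
  · by_cases hs : (⟨(x, κ), h⟩ : S) = s
    · have hx : x = s.1.1 := by rw [← hs]
      have hκ : κ = s.1.2 := by rw [← hs]
      have hb : bump s.1.1 s.1.2 X x κ = X := by simp [bump, hx, hκ]
      rw [hb]
      simp only [insCfg, h, dite_true]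
      rw [hs, Pi.single_eq_same]
    · have hne : ¬(x = s.1.1 ∧ κ = s.1.2) := by
        rintro ⟨rfl, rfl⟩; exact hs (Subtype.ext rfl)
      simp only [insCfg, h, dite_true, bump, hne, if_false]
      rw [Pi.single_apply, if_neg hs]
  · have hne : ¬(x = s.1.1 ∧ κ = s.1.2) := by
      rintro ⟨rfl, rfl⟩; exact h s.2
    simp only [insCfg, h, dite_false, bump, hne, if_false]

omit [CompleteSpace 𝔸] in
/-- The complex line `a + t·X·δ_s` in `𝔸^S` is inserted as b07's line `B + t·bump_s X` ((137): `A + tδA`).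
[cite: Balaban1985Averaging, (137) p.39] (elementary API; our proof) -/
theorem insCfg_line (S : Finset (Site d × Fin d)) (a : S → 𝔸) (s : S) (X : 𝔸) (t : ℂ) :
    insCfg S (a + t • (Pi.single s X : S → 𝔸)) = insCfg S a + t • bump s.1.1 s.1.2 X := by
  rw [insCfg_add, insCfg_smul, insCfg_single]

/-! ## §2 The composite averaging on finite products and its analyticity (Prop. 4, BY NAME) -/

/-- **`Q_k(1, B)` as a map `𝔸^S → 𝔸^T`**: the variables are the bond variables `B_s`, `s ∈ S` (the others frozen at `0`,
`insCfg`), the values are the coarse bond variables `Q_k(1, B)(c)`, `c ∈ T` (`logIter`, the composite (127) at `U₀ = 1`).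
[cite: Balaban1985Averaging, (127) p.37, Prop. 4 p.38] -/
def avgMap (L : ℕ) (S T : Finset (Site d × Fin d)) (k : ℕ) (a : S → 𝔸) : T → 𝔸 :=
  fun c => logIter L (insCfg S a) k c.1.1 c.1.2

/-- Unfolding of `avgMap`. [cite: Balaban1985Averaging, (127) p.37] (elementary API) -/
@[simp] theorem avgMap_apply (L : ℕ) (S T : Finset (Site d × Fin d)) (k : ℕ) (a : S → 𝔸) (c : T) :
    avgMap L S T k a c = logIter L (insCfg S a) k c.1.1 c.1.2 := rfl

omit [NormedAlgebra ℂ 𝔸] [CompleteSpace 𝔸] in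
/-- `sup_s ‖a_s‖ ≤ b` is `‖a‖ ≤ b` for the sup norm of `𝔸^S` (`b ≥ 0`) — bookkeeping. [folklore] -/
private theorem pi_norm_le_of_forall {S : Finset (Site d × Fin d)} {a : S → 𝔸} {b : ℝ} (hb : 0 ≤ b)
    (ha : ∀ s, ‖a s‖ ≤ b) : ‖a‖ ≤ b :=
  (pi_norm_le_iff_of_nonneg hb).2 ha

omit [NormedAlgebra ℂ 𝔸] [CompleteSpace 𝔸] in
/-- The inserted field is bounded by the coordinate bound: `‖ins(a)_b‖ ≤ b`. [cite: Balaban1985Averaging, (109) p.34]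
(elementary API; our proof) -/
theorem norm_insCfg_le_of_le {S : Finset (Site d × Fin d)} {a : S → 𝔸} {b : ℝ} (hb : 0 ≤ b)
    (ha : ∀ s, ‖a s‖ ≤ b) (x : Site d) (κ : Fin d) : ‖insCfg S a x κ‖ ≤ b :=
  (norm_insCfg_le S a x κ).trans (pi_norm_le_of_forall hb ha)

/-- b07's smallness `C₃(d, L)·t ≤ 1` implies Prop. 4's `8C₁(d)·t ≤ 1` (`C₃ = 128(d+1)C₁L^d ≥ 32C₁`,
`B7Prop5Flat.small32_of_C3`). [cite: Balaban1985Averaging, Prop. 4 p.38, (155) p.41] (elementary API; our proof) -/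
theorem small8_of_C3 (d L : ℕ) (hL : 1 ≤ L) {t : ℝ} (ht : 0 ≤ t) (h : C3 d L * t ≤ 1) : 8 * C1 d * t ≤ 1 := by
  have h32 := small32_of_C3 d L hL ht h
  have hC1 := C1_pos d
  nlinarith [mul_nonneg hC1.le ht]

/-- **Prop. 4's analyticity clause, transported**: under `sup_s ‖a_s‖ ≤ b`, `C₃L^kb ≤ 1`, every component
`a′ ↦ Q_k(1, ins a′)(c)` of `avgMap` is analytic at `a` (`B7Prop4Flat.prop4_flat_analyticAt`, BY NAME, with the bondwise
analytic parametrisation `insCfg`). [cite: Balaban1985Averaging, Prop. 4 p.38] -/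
theorem analyticAt_avgMap_apply (L : ℕ) (hL : 2 ≤ L) (S T : Finset (Site d × Fin d)) (k : ℕ) {b : ℝ}
    (hb : 0 ≤ b) (hk : C3 d L * ((L : ℝ) ^ k * b) ≤ 1) {a : S → 𝔸} (ha : ∀ s, ‖a s‖ ≤ b) (c : T) :
    AnalyticAt ℂ (fun a' : S → 𝔸 => avgMap L S T k a' c) a := by
  have hL1 : 1 ≤ L := le_trans (by norm_num) hL
  have h8 : 8 * C1 d * ((L : ℝ) ^ k * b) ≤ 1 := small8_of_C3 d L hL1 (by positivity) hk
  exact prop4_flat_analyticAt L hL (fun a' : S → 𝔸 => insCfg S a') (fun x κ' => analyticAt_insCfg S x κ' a) hb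
    (fun x κ' => norm_insCfg_le_of_le hb ha x κ') k h8 k le_rfl c.1.1 c.1.2

/-- `avgMap` is (complex) Fréchet differentiable at every point of the closed polydisc `sup_s ‖a_s‖ ≤ b`, `C₃L^kb ≤ 1`.
[cite: Balaban1985Averaging, Prop. 4 p.38, (137)–(138) p.39] -/
theorem differentiableAt_avgMap (L : ℕ) (hL : 2 ≤ L) (S T : Finset (Site d × Fin d)) (k : ℕ) {b : ℝ}
    (hb : 0 ≤ b) (hk : C3 d L * ((L : ℝ) ^ k * b) ≤ 1) {a : S → 𝔸} (ha : ∀ s, ‖a s‖ ≤ b) :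
    DifferentiableAt ℂ (avgMap L S T k) a :=
  differentiableAt_pi.2 fun c => (analyticAt_avgMap_apply L hL S T k hb hk ha c).differentiableAt

/-! ## §3 The partial derivatives are b07's single-bond differentials: (156) per bond, and locality -/

/-- **`∂_s Q_k(1, ·)(c)·X = dC_k(B; X·δ_s)(c) + L^kη·(Q_k(1)(X·δ_s))(c)`**: the Fréchet partial derivative of `avgMap` in
the variable `s` applied to `X` is b07's single-bond differential (137) of `Q_k(1, ·)(c) = C_k + L^kη·Q_k(1)` at `B = ins a`
in the direction `bump s X` (`prop5_flat_156_B`: the line derivative; uniqueness of the derivative along the inserted complex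
line `ins(a + tX·δ_s) = B + t·bump_s X`). [cite: Balaban1985Averaging, (137)–(138) p.39, (156) p.42, (134) p.38] -/
theorem fderiv_avgMap_single (L : ℕ) (hL : 2 ≤ L) (S T : Finset (Site d × Fin d)) (k : ℕ) {b : ℝ} (hb : 0 ≤ b)
    (hk : C3 d L * ((L : ℝ) ^ k * b) ≤ 1) {a : S → 𝔸} (ha : ∀ s, ‖a s‖ ≤ b) (s : S) (X : 𝔸) (c : T) :
    fderiv ℂ (avgMap L S T k) a (Pi.single s X) c =
      dC L (insCfg S a) (bump s.1.1 s.1.2 X) k c.1.1 c.1.2 + linQIter L (bump s.1.1 s.1.2 X) k c.1.1 c.1.2 := by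
  have hD := differentiableAt_avgMap L hL S T k hb hk ha
  -- the derivative of `avgMap` along the line `a + t·X·δ_s`, component `c`
  have hline : HasDerivAt (fun t : ℂ => a + t • (Pi.single s X : S → 𝔸)) (Pi.single s X) 0 := by
    simpa using ((hasDerivAt_id (0 : ℂ)).smul_const (Pi.single s X : S → 𝔸)).const_add a
  have hD' : HasFDerivAt (avgMap L S T k) (fderiv ℂ (avgMap L S T k) a)
      (a + (0 : ℂ) • (Pi.single s X : S → 𝔸)) := by
    rw [zero_smul, add_zero]; exact hD.hasFDerivAt
  have h1 : HasDerivAt (fun t : ℂ => avgMap L S T k (a + t • (Pi.single s X : S → 𝔸)))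
      (fderiv ℂ (avgMap L S T k) a (Pi.single s X)) 0 := by
    have h := hD'.comp_hasDerivAt (0 : ℂ) hline
    simpa only [Function.comp_def] using h
  have h1c : HasDerivAt (fun t : ℂ => avgMap L S T k (a + t • (Pi.single s X : S → 𝔸)) c)
      (fderiv ℂ (avgMap L S T k) a (Pi.single s X) c) 0 := (hasDerivAt_pi.1 h1) c
  -- b07's line derivative of `Q_k(1, ·)(c)` at `B = ins a` in the direction `bump s X`
  obtain ⟨h2, -⟩ := prop5_flat_156_B L hL (insCfg S a) hb (fun x κ' => norm_insCfg_le_of_le hb ha x κ') k hk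
    s.1.1 s.1.2 X c.1.1 c.1.2
  have h2' : HasDerivAt (fun t : ℂ => logIter L (insCfg S a + t • bump s.1.1 s.1.2 X) k c.1.1 c.1.2)
      (dC L (insCfg S a) (bump s.1.1 s.1.2 X) k c.1.1 c.1.2 + linQIter L (bump s.1.1 s.1.2 X) k c.1.1 c.1.2) 0 := h2
  have h2'' : HasDerivAt (fun t : ℂ => avgMap L S T k (a + t • (Pi.single s X : S → 𝔸)) c)
      (dC L (insCfg S a) (bump s.1.1 s.1.2 X) k c.1.1 c.1.2 + linQIter L (bump s.1.1 s.1.2 X) k c.1.1 c.1.2) 0 := by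
    refine h2'.congr_of_eventuallyEq (Filter.Eventually.of_forall fun t => ?_)
    simp only [avgMap_apply, insCfg_line]
  exact h1c.unique h2''

/-- **(156) AT `U₀ = 1`, PER BOND, for the partial derivatives of `avgMap`**: `‖∂_s Q_k(1, ·)(c)·X‖ ≤
(L^k·L^{−kd} + C₃(L^k)²L^{−kd}b)·‖X‖` — «|(δ/δA_b) Q_k(U₀, ηA, c)| ≤ 1 + 2C′₁α₀ + C₃|A|» with `α₀ = 0`, times the `η^d`
of (138) and the `L^k` of the `B`-variables (`prop5_flat_156_B` BY NAME). [cite: Balaban1985Averaging, Prop. 5 (156) p.42, (138) p.39] -/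
theorem norm_fderiv_avgMap_single_le (L : ℕ) (hL : 2 ≤ L) (S T : Finset (Site d × Fin d)) (k : ℕ) {b : ℝ}
    (hb : 0 ≤ b) (hk : C3 d L * ((L : ℝ) ^ k * b) ≤ 1) {a : S → 𝔸} (ha : ∀ s, ‖a s‖ ≤ b) (s : S) (X : 𝔸)
    (c : T) :
    ‖fderiv ℂ (avgMap L S T k) a (Pi.single s X) c‖ ≤
      ((L : ℝ) ^ k * (((L : ℝ) ^ k) ^ d)⁻¹ + K5 d L b k) * ‖X‖ := by
  rw [fderiv_avgMap_single L hL S T k hb hk ha s X c]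
  exact (prop5_flat_156_B L hL (insCfg S a) hb (fun x κ' => norm_insCfg_le_of_le hb ha x κ') k hk
    s.1.1 s.1.2 X c.1.1 c.1.2).2

/-- **LOCALITY of the partial derivatives** (Prop. 4: `Q_k(U₀, ηA, c)` «is an analytic function of the variables A_b,
b ⊂ B^k(c₋)∪B^k(c₊)»; (141)): `∂_s Q_k(1, ·)(c) = 0` unless the bond `s` lies in the box `[loK L k z, bondHiK L k z κ]`
of `c = (z, κ)` (`prop5_flat_157_B` locality clause + `linQIter_bump_eq_zero`, BY NAME).
[cite: Balaban1985Averaging, Prop. 4 p.38, (141) p.39, (157) p.42] -/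
theorem fderiv_avgMap_single_eq_zero (L : ℕ) (hL : 2 ≤ L) (S T : Finset (Site d × Fin d)) (k : ℕ) {b : ℝ}
    (hb : 0 ≤ b) (hk : C3 d L * ((L : ℝ) ^ k * b) ≤ 1) {a : S → 𝔸} (ha : ∀ s, ‖a s‖ ≤ b) (s : S) (X : 𝔸)
    (c : T) (hnot : ¬ BondIn (loK L k c.1.1) (bondHiK L k c.1.1 c.1.2) s.1.1 s.1.2) :
    fderiv ℂ (avgMap L S T k) a (Pi.single s X) c = 0 := by
  rw [fderiv_avgMap_single L hL S T k hb hk ha s X c,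
    (prop5_flat_157_B L hL (insCfg S a) hb (fun x κ' => norm_insCfg_le_of_le hb ha x κ') k hk
      s.1.1 s.1.2 X c.1.1 c.1.2).2.2 hnot,
    linQIter_bump_eq_zero L s.1.1 s.1.2 X k c.1.1 c.1.2 hnot, add_zero]

/-! ## §4 The row count: at most `2d·L^{kd}` fine bonds in `B^k(c₋) ∪ B^k(c₊)` -/

/-- The box `[L^kz, L^kz + (L^k − 1)𝟙 + L^ke_κ]` (`B^k(c₋) ∪ B^k(c₊)` read on the fine lattice) has exactly `2·L^{kd}`
sites. [cite: Balaban1985Averaging, (141) p.39, p.24] (elementary API; our count) -/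
theorem card_boxFinset_K (L : ℕ) (k : ℕ) (z : Site d) (κ : Fin d) :
    (boxFinset (loK L k z) (bondHiK L k z κ)).card = 2 * (L ^ k) ^ d := by
  classical
  rw [boxFinset, Fintype.card_piFinset]
  have hterm : ∀ i, (Finset.Icc (loK L k z i) (bondHiK L k z κ i)).card = (if i = κ then 2 else 1) * L ^ k := by
    intro i
    rw [Int.card_Icc]
    simp only [loK, bondHiK]
    split_ifs with hi
    · have h1 : (L : ℤ) ^ k * z i + ((L : ℤ) ^ k - 1) + (L : ℤ) ^ k + 1 - (L : ℤ) ^ k * z i =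
          ((2 * L ^ k : ℕ) : ℤ) := by push_cast; ring
      rw [h1, Int.toNat_natCast]
    · have h1 : (L : ℤ) ^ k * z i + ((L : ℤ) ^ k - 1) + 0 + 1 - (L : ℤ) ^ k * z i = ((1 * L ^ k : ℕ) : ℤ) := by
        push_cast; ring
      rw [h1, Int.toNat_natCast]
  simp_rw [hterm]
  rw [Finset.prod_mul_distrib, Finset.prod_const, Finset.card_univ, Fintype.card_fin,
    Finset.prod_eq_single κ (fun i _ hi => if_neg hi) (fun h => absurd (Finset.mem_univ κ) h), if_pos rfl]

/-- At most `d` bonds per lower endpoint: `#bondsIn [lo, hi] ≤ #[lo, hi]·d`. [cite: Balaban1985Averaging, (140)–(141) p.39]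
(elementary API; our count) -/
theorem card_bondsIn_le (lo hi : Site d) : (bondsIn lo hi).card ≤ (boxFinset lo hi).card * d := by
  unfold bondsIn
  calc ((boxFinset lo hi ×ˢ (Finset.univ : Finset (Fin d))).filter
          fun s => s.1 + e s.2 ∈ boxFinset lo hi).card
      ≤ (boxFinset lo hi ×ˢ (Finset.univ : Finset (Fin d))).card := Finset.card_filter_le _ _
    _ = (boxFinset lo hi).card * d := by rw [Finset.card_product, Finset.card_univ, Fintype.card_fin]

open Classical in
/-- **The count behind (141)/(142)**: among the variables `S`, at most `2d·L^{kd}` bonds lie in the box `B^k(c₋) ∪ B^k(c₊)`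
of a coarse bond `c = (z, κ)` (so that `Σ_{b⊂B^k(c₋)∪B^k(c₊)} η^d ≤ 2d` in (141)'s normalisation).
[cite: Balaban1985Averaging, (141)–(142) p.39] (elementary API; our count) -/
theorem card_filter_bondIn_le (S : Finset (Site d × Fin d)) (L : ℕ) (k : ℕ) (z : Site d) (κ : Fin d) :
    (S.filter fun s => BondIn (loK L k z) (bondHiK L k z κ) s.1 s.2).card ≤ 2 * d * (L ^ k) ^ d := by
  calc (S.filter fun s => BondIn (loK L k z) (bondHiK L k z κ) s.1 s.2).card
      ≤ (bondsIn (loK L k z) (bondHiK L k z κ)).card :=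
        Finset.card_le_card fun s hs => mem_bondsIn.2 (Finset.mem_filter.1 hs).2
    _ ≤ (boxFinset (loK L k z) (bondHiK L k z κ)).card * d := card_bondsIn_le _ _
    _ = 2 * d * (L ^ k) ^ d := by rw [card_boxFinset_K L k z κ]; ring

/-- The per-bond size times the count: `2d·L^{kd}·(L^kL^{−kd} + C₃(L^k)²L^{−kd}b) = 2dL^k(1 + C₃L^kb)` — bookkeeping.
[cite: Balaban1985Averaging, (156) p.42, (141) p.39] (elementary API; our arithmetic) -/
theorem count_mul_perBond_eq (L : ℕ) (hL : 1 ≤ L) (k : ℕ) (b : ℝ) :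
    (2 * (d : ℝ) * ((L : ℝ) ^ k) ^ d) * ((L : ℝ) ^ k * (((L : ℝ) ^ k) ^ d)⁻¹ + K5 d L b k) =
      2 * d * (L : ℝ) ^ k * (1 + C3 d L * ((L : ℝ) ^ k * b)) := by
  have hL0 : (0 : ℝ) < L := by exact_mod_cast (show 0 < L from hL)
  have hP : (((L : ℝ) ^ k) ^ d) ≠ 0 := by positivity
  have hPinv : (((L : ℝ) ^ k) ^ d)⁻¹ * ((L : ℝ) ^ k) ^ d = 1 := inv_mul_cancel₀ hP
  unfold K5
  calc (2 * (d : ℝ) * ((L : ℝ) ^ k) ^ d) *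
        ((L : ℝ) ^ k * (((L : ℝ) ^ k) ^ d)⁻¹ + C3 d L * ((L : ℝ) ^ k) ^ 2 * (((L : ℝ) ^ k) ^ d)⁻¹ * b)
      = 2 * d * (L : ℝ) ^ k * (1 + C3 d L * ((L : ℝ) ^ k * b)) * ((((L : ℝ) ^ k) ^ d)⁻¹ * ((L : ℝ) ^ k) ^ d) := by
        ring
    _ = 2 * d * (L : ℝ) ^ k * (1 + C3 d L * ((L : ℝ) ^ k * b)) := by rw [hPinv, mul_one]

open Classical in
/-- **Row sums**: for a coarse bond `c = (z, κ)`, the matrix of per-bond bounds `M_{c,s} = (L^kL^{−kd} + K5)·𝟙[s ⊂ box(c)]`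
has `Σ_{s∈S} M_{c,s} ≤ 2dL^k(1 + C₃L^kb)`. [cite: Balaban1985Averaging, (141)–(142) p.39, (156) p.42]
(elementary API; our count) -/
theorem rowSum_avgMap_le (L : ℕ) (hL : 1 ≤ L) (S : Finset (Site d × Fin d)) (k : ℕ) {b : ℝ} (hb : 0 ≤ b)
    (z : Site d) (κ : Fin d) :
    ∑ p ∈ S, (if BondIn (loK L k z) (bondHiK L k z κ) p.1 p.2 then
        (L : ℝ) ^ k * (((L : ℝ) ^ k) ^ d)⁻¹ + K5 d L b k else 0) ≤
      2 * d * (L : ℝ) ^ k * (1 + C3 d L * ((L : ℝ) ^ k * b)) := by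
  set m : ℝ := (L : ℝ) ^ k * (((L : ℝ) ^ k) ^ d)⁻¹ + K5 d L b k with hm
  have hm0 : 0 ≤ m := add_nonneg (by positivity) (K5_nonneg d L hb k)
  rw [Finset.sum_ite, Finset.sum_const_zero, add_zero, Finset.sum_const, nsmul_eq_mul, ← count_mul_perBond_eq L hL k b]
  have hcard : ((S.filter fun p => BondIn (loK L k z) (bondHiK L k z κ) p.1 p.2).card : ℝ) ≤
      2 * (d : ℝ) * ((L : ℝ) ^ k) ^ d := by
    exact_mod_cast card_filter_bondIn_le S L k z κ
  exact mul_le_mul_of_nonneg_right hcard hm0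

/-! ## §5 The sup → sup operator bound on `D Q_k(1, ·)` (Proposition 5 at `U₀ = 1`, operator form) -/

/-- **PROPOSITION 5 AT `U₀ = 1`, OPERATOR FORM**: on the finite products `𝔸^S → 𝔸^T` (sup norms), for `L ≥ 2`,
`sup_s ‖a_s‖ ≤ b`, `C₃(d, L)·L^k·b ≤ 1`, the Fréchet derivative of `B ↦ Q_k(1, B)` at `B = ins a` has operator norm
`≤ 2dL^k(1 + C₃L^kb)` — the per-bond bound (156) summed over the `≤ 2d·L^{kd}` bonds of `B^k(c₋) ∪ B^k(c₊)` with the weight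
`η^d = L^{−kd}` of (138)/(141), row by row (`f(v) = Σ_s f(v_s·δ_s)`).  In `A`-variables (`B = ηA`) this is the
`η`-independent bound «the functional derivative of Q_k(U₀, ηA) is bounded by a constant independent of η» (p. 39) in operator
form, `≤ 2d(1 + C₃α₁)`; the factor `L^k` is the scale of the argument ((150); [Balaban1987RG1] (3.49)).
[cite: Balaban1985Averaging, Prop. 5 (156) p.42, (138) p.39, (141) p.39, (150) p.40] -/
theorem opNorm_fderiv_avgMap_le (L : ℕ) (hL : 2 ≤ L) (S T : Finset (Site d × Fin d)) (k : ℕ) {b : ℝ}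
    (hb : 0 ≤ b) (hk : C3 d L * ((L : ℝ) ^ k * b) ≤ 1) {a : S → 𝔸} (ha : ∀ s, ‖a s‖ ≤ b) :
    ‖fderiv ℂ (avgMap L S T k) a‖ ≤ 2 * d * (L : ℝ) ^ k * (1 + C3 d L * ((L : ℝ) ^ k * b)) := by
  classical
  have hL1 : 1 ≤ L := le_trans (by norm_num) hL
  have hL0 : (0 : ℝ) < L := by exact_mod_cast (show 0 < L from hL1)
  set f := fderiv ℂ (avgMap L S T k) a with hf
  set m : ℝ := (L : ℝ) ^ k * (((L : ℝ) ^ k) ^ d)⁻¹ + K5 d L b k with hm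
  have hm0 : 0 ≤ m := add_nonneg (by positivity) (K5_nonneg d L hb k)
  have hK0 : 0 ≤ 2 * d * (L : ℝ) ^ k * (1 + C3 d L * ((L : ℝ) ^ k * b)) := by
    have := C3_pos d L hL1
    positivity
  refine ContinuousLinearMap.opNorm_le_bound f hK0 fun v => ?_
  refine (pi_norm_le_iff_of_nonneg (by positivity)).mpr fun c => ?_
  have hdec : f v = ∑ s, f (Pi.single s (v s)) := by
    conv_lhs => rw [← Finset.univ_sum_single v]
    rw [map_sum]
  rw [hdec, Finset.sum_apply]
  -- per-bond bounds, with locality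
  have hM : ∀ s : S, ‖f (Pi.single s (v s)) c‖ ≤
      (if BondIn (loK L k c.1.1) (bondHiK L k c.1.1 c.1.2) s.1.1 s.1.2 then m else 0) * ‖v‖ := by
    intro s
    split_ifs with hs
    · exact (norm_fderiv_avgMap_single_le L hL S T k hb hk ha s (v s) c).trans
        (mul_le_mul_of_nonneg_left (norm_le_pi_norm v s) hm0)
    · rw [hf, fderiv_avgMap_single_eq_zero L hL S T k hb hk ha s (v s) c hs, norm_zero, zero_mul]
  have hcoe : ∑ s : S, (if BondIn (loK L k c.1.1) (bondHiK L k c.1.1 c.1.2) s.1.1 s.1.2 then m else 0) =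
      ∑ p ∈ S, (if BondIn (loK L k c.1.1) (bondHiK L k c.1.1 c.1.2) p.1 p.2 then m else 0) :=
    Finset.sum_coe_sort S (fun p => if BondIn (loK L k c.1.1) (bondHiK L k c.1.1 c.1.2) p.1 p.2 then m else 0)
  calc ‖∑ s, f (Pi.single s (v s)) c‖ ≤ ∑ s, ‖f (Pi.single s (v s)) c‖ := norm_sum_le _ _
    _ ≤ ∑ s : S, (if BondIn (loK L k c.1.1) (bondHiK L k c.1.1 c.1.2) s.1.1 s.1.2 then m else 0) * ‖v‖ :=
        Finset.sum_le_sum fun s _ => hM s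
    _ = (∑ p ∈ S, (if BondIn (loK L k c.1.1) (bondHiK L k c.1.1 c.1.2) p.1 p.2 then m else 0)) * ‖v‖ := by
        rw [← Finset.sum_mul, hcoe]
    _ ≤ 2 * d * (L : ℝ) ^ k * (1 + C3 d L * ((L : ℝ) ^ k * b)) * ‖v‖ :=
        mul_le_mul_of_nonneg_right (rowSum_avgMap_le L hL1 S k hb c.1.1 c.1.2) (norm_nonneg v)

/-! ### Real-scalar forms (the shape differentiated over `ℝ` in [Balaban1987RG1] (3.48)–(3.49)) -/

/-- `avgMap` is real-differentiable on the polydisc (restriction of scalars). [cite: Balaban1985Averaging, Prop. 4 p.38] -/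
theorem differentiableAt_avgMap_real (L : ℕ) (hL : 2 ≤ L) (S T : Finset (Site d × Fin d)) (k : ℕ) {b : ℝ}
    (hb : 0 ≤ b) (hk : C3 d L * ((L : ℝ) ^ k * b) ≤ 1) {a : S → 𝔸} (ha : ∀ s, ‖a s‖ ≤ b) :
    DifferentiableAt ℝ (avgMap L S T k) a :=
  (differentiableAt_avgMap L hL S T k hb hk ha).restrictScalars ℝ

/-- The real Fréchet derivative of `avgMap` is the complex one with scalars restricted: same values.
[cite: Balaban1985Averaging, (137)–(138) p.39] (elementary API; our proof) -/
theorem fderiv_real_avgMap_apply (L : ℕ) (hL : 2 ≤ L) (S T : Finset (Site d × Fin d)) (k : ℕ) {b : ℝ}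
    (hb : 0 ≤ b) (hk : C3 d L * ((L : ℝ) ^ k * b) ≤ 1) {a : S → 𝔸} (ha : ∀ s, ‖a s‖ ≤ b) (v : S → 𝔸) :
    fderiv ℝ (avgMap L S T k) a v = fderiv ℂ (avgMap L S T k) a v := by
  rw [((differentiableAt_avgMap L hL S T k hb hk ha).hasFDerivAt.restrictScalars ℝ).fderiv]
  rfl

/-- **PROPOSITION 5 AT `U₀ = 1`, OPERATOR FORM over `ℝ`**: `‖D_ℝ Q_k(1, ·)(ins a)‖ ≤ 2dL^k(1 + C₃L^kb)` — the hypothesis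
shape `‖fderiv ℝ Q y‖ ≤ C·L^j` of `B12QPrime348.ineq349_lam330` for `Q = avgMap`, with `C = 2d(1 + C₃L^kb) ≤ 4d`.
[cite: Balaban1985Averaging, Prop. 5 (156) p.42, (150) p.40] -/
theorem opNorm_fderiv_real_avgMap_le (L : ℕ) (hL : 2 ≤ L) (S T : Finset (Site d × Fin d)) (k : ℕ) {b : ℝ}
    (hb : 0 ≤ b) (hk : C3 d L * ((L : ℝ) ^ k * b) ≤ 1) {a : S → 𝔸} (ha : ∀ s, ‖a s‖ ≤ b) :
    ‖fderiv ℝ (avgMap L S T k) a‖ ≤ 2 * d * (L : ℝ) ^ k * (1 + C3 d L * ((L : ℝ) ^ k * b)) := by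
  rw [((differentiableAt_avgMap L hL S T k hb hk ha).hasFDerivAt.restrictScalars ℝ).fderiv,
    ContinuousLinearMap.norm_restrictScalars]
  exact opNorm_fderiv_avgMap_le L hL S T k hb hk ha

/-- **The per-bond data over `ℝ`** in the shape consumed by `B12Ineq349PerBond.ineq349_lam330_local`: on the polydisc the
real partial derivative in the variable `s` satisfies `‖∂_s(c)·X‖ ≤ (L^kL^{−kd} + K5)‖X‖` for `s ⊂ box(c)` and vanishes
otherwise. [cite: Balaban1985Averaging, Prop. 5 (156) p.42, (141) p.39] -/
theorem fderiv_real_avgMap_single_bound (L : ℕ) (hL : 2 ≤ L) (S T : Finset (Site d × Fin d)) (k : ℕ) {b : ℝ}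
    (hb : 0 ≤ b) (hk : C3 d L * ((L : ℝ) ^ k * b) ≤ 1) {a : S → 𝔸} (ha : ∀ s, ‖a s‖ ≤ b) (s : S) (X : 𝔸)
    (c : T) :
    ‖fderiv ℝ (avgMap L S T k) a (Pi.single s X) c‖ ≤ ((L : ℝ) ^ k * (((L : ℝ) ^ k) ^ d)⁻¹ + K5 d L b k) * ‖X‖ ∧
      (¬ BondIn (loK L k c.1.1) (bondHiK L k c.1.1 c.1.2) s.1.1 s.1.2 →
        fderiv ℝ (avgMap L S T k) a (Pi.single s X) c = 0) := by
  rw [fderiv_real_avgMap_apply L hL S T k hb hk ha]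
  exact ⟨norm_fderiv_avgMap_single_le L hL S T k hb hk ha s X c,
    fun hnot => fderiv_avgMap_single_eq_zero L hL S T k hb hk ha s X c hnot⟩

end Literature.MathematicalPhysics.QuantumFieldTheory.Balaban1983to89.B7Prop5FlatOperator

end
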